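import Summits.QuantumFields.BalabanUV.Beta.SymMixedWardSiteLaw
import Summits.QuantumFields.BalabanUV.Beta.DiagonalContact
import Summits.QuantumFields.BalabanUV.Beta.AveragingWardRootedStencils
import Summits.QuantumFields.BalabanUV.Beta.SymSecondOrderTablesAn1

/-!
# `BalabanUV.Beta.D1BFx.CombMixedSiteLetter` — road «BF-x», binder row D1, PART 24 HEAD (H2-letters), C-g24-4: **THE LITERAL OF RECORD's
# MIXED TABLE OBEYS THE SITE-LAW-SHAPED SLOT LETTER** (left multiplication + anchor, NOT a commutator) — the instance of the binder
# `hMsite` of leaf-03 g31's `SymCorrectorW2SiteGauge` (TT20) at the record's tables.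

§1 is leaf-03 g31's scratch theorem (bytes `HOME/b2b-balaban-beta-d1-formalise-leaf-03/g31/tt/SCRATCH-MixedSiteLetter-packed-symSiteWardM.rc0.lean`,
offered l.52145, taken with credit): an1's mixed site Ward law `SymMixedWardSiteLaw.symMixKerAt_siteWard` PACKED entrywise into an2's `MKer` language —
`divV (κ u ↦ symMixFFAt ρ L κ u μ y) u′ = 2 • ([u′ = L•y + ρ] • symHessFFAt ρ L μ y − diagK (legInd ρ u′) ∘ symHessFFAt ρ L μ y)` (generic `d`, any root).
§2 is the RECORD's instance (`d = 3`, root `ρ_c = ctr 4 n`, level `0`): the weighted mixed table `M₂⁰ := M2Of 3 n (symTablesAn1S2 3 n cΛ).mixFF 0`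
(`wM2 0 = 1`) against the constraint Hessian `H := symHessFFAt ρ_c n` at scalar `2` (NO side condition), and against the record's own multiplier table
`M⁰ := (symTablesAn1S2 3 n cΛ).M 0 = cΛ • H` at scalar `2∕cΛ` UNDER `cΛ ≠ 0` (displayed) — the letter's table in TT20's `hMsite` is `W2SymOfK`'s own `M`.

HONEST DEPENDENCY (cell records, verbatim): «continuum YM on T⁴ ⇐ BetaPertH ∧ nine spine estimates (0/9 proved); BetaPertH ⇐ (D1) ∧ (D4) ∧
CAP+tail; G-an2-4 gates asym, D1 and NE2/3/4.»  HONEST FRAMING (cell contract, verbatim): «discharging `BetaPertH` makes Bałaban's UV stability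
UNCONDITIONAL — a real constructive-QFT result; it is NOT the continuum limit and NOT the Clay problem.»  THIS MODULE DISCHARGES NO binder of row D1 and
NO estimate of Bałaban's: [folklore] identities of OUR tables (an1's site law, by name); prices nothing; no definition, no `def … : Prop`, nothing cited,
0 sorry.  0∕4 row-D1 binders; (K) NOT closed; (J1) ONE OPEN ROW; NOT D1, NEVER «G-an2-4 closed», NOT `BetaPertH`, NOT continuum, NOT Clay.

ABSOLUTE RULE (cell charter, verbatim): «No internally-minted statement may enter as a cited fact. Every hypothesis is either kernel-proved in this
package or a verbatim quotation of a PUBLISHED theorem with page reference. The manuscript(s) under audit are NOT citable for their own disputed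
steps — they are the thing under adjudication; programme-internal (2001/route/tribunal) claims are never citable.»

Unit `b2b-balaban-beta-d1-p2` (road owner, gen 24), 2026-08-23; §1 = leaf-03 g31's bytes (credit); no existing file touched.
-/

noncomputable section

namespace Summit.QuantumFields.BalabanUV.Beta.D1BFx.CombMixedSiteLetter

open Finset
open scoped BigOperators
open Literature.MathematicalPhysics.QuantumFieldTheory.Balaban1983to89
open Literature.MathematicalPhysics.QuantumFieldTheory.Balaban1983to89.Beta
open ExpKernelCalculus (MKer comp)
open OneStepResolventKernel (Fib)
open KernelWard (divV)
open BalabanStepW2 (M2Of wM2 wM1)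
open AffineAveraging (Site)
open AveragingContoursRooted (ctr)
open Summit.QuantumFields.BalabanUV.Beta.BorderedHessian (diagK comp_diagK_left)
open Summit.QuantumFields.BalabanUV.Beta.AveragingWardRootedStencils (legInd legInd_inl legInd_inr)
open Summit.QuantumFields.BalabanUV.Beta.SymAveragingHessianCounts (symHessFFAt symHessFFAt_inl_inl symHessFFAt_inl_inr symHessFFAt_inr)
open Summit.QuantumFields.BalabanUV.Beta.SymAveragingMixedJetTables (symMixFFAt symMixFFAt_inl_inl symMixFFAt_inl_inr symMixFFAt_inr)
open Summit.QuantumFields.BalabanUV.Beta.SymMixedWardSiteLaw (symMixKerAt_siteWard)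
open Summit.QuantumFields.BalabanUV.Beta.WardLocusStencils (divV_apply)
open Summit.QuantumFields.BalabanUV.Beta.SpineRooted (M1Of M1Of_apply)
open Summit.QuantumFields.BalabanUV.Beta.SymSecondOrderTablesAn1 (symTablesAn1S2 symTablesAn1S2_mixFF symTablesAn1S2_M)

variable {d : ℕ}

/-! ## §1 The packed site law (leaf-03 g31's bytes): generic `d`, any root -/

open Classical in
/-- [folklore] **THE SYMMETRISED MIXED TABLE OBEYS A SITE-LAW-SHAPED SLOT LETTER** (left multiplication + anchor), generic `d`, any root `ρ`:
`divV (κ u ↦ symMixFFAt ρ L κ u μ y) u′ = 2 • ([u′ = L•y + ρ] • symHessFFAt ρ L μ y − diagK (legInd ρ u′) ∘ symHessFFAt ρ L μ y)` — an1's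
`SymMixedWardSiteLaw.symMixKerAt_siteWard` packed entrywise (fm block = the law; ff ∕ mf ∕ mm blocks vanish on both sides).  (leaf-03 g31's scratch
theorem, credit.) -/
theorem divV_symMixFFAt_eq {L : ℕ} (hL : L ≠ 0) (ρ : Fin (d + 1) → ℤ) (μ : Fin (d + 1)) (y u' : Fin (d + 1) → ℤ) :
    divV (fun κ u => symMixFFAt ρ L κ u μ y) u'
      = (2 : ℝ) • ((if u' = (L : ℤ) • y + ρ then (1 : ℝ) else 0) • symHessFFAt ρ L μ y
          - comp (diagK (legInd ρ u')) (symHessFFAt ρ L μ y)) := by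
  have hU : ∀ κ : Fin (d + 1), (B6BondElimination.unitVec κ : Fin (d + 1) → ℤ) = AffineAveraging.unitVec κ := fun κ => by
    funext i
    simp only [B6BondElimination.unitVec, AffineAveraging.unitVec, Pi.single_apply]
  funext x z a b
  rw [divV_apply, Pi.smul_apply, Pi.smul_apply, Pi.smul_apply, Pi.smul_apply, Pi.sub_apply, Pi.sub_apply, Pi.sub_apply, Pi.sub_apply,
    comp_diagK_left, Pi.smul_apply, Pi.smul_apply, Pi.smul_apply, Pi.smul_apply]
  rcases a with β | m <;> rcases b with β' | m'
  · simp only [symMixFFAt_inl_inl, symHessFFAt_inl_inl, legInd_inl, hU, smul_eq_mul]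
    rw [symMixKerAt_siteWard hL ρ μ y u' (β, x) (β', z)]
    have e : (if u' = x then (1 : ℝ) else 0) = (if x = u' then (1 : ℝ) else 0) := by simp only [eq_comm]
    rw [e]
    ring
  · simp only [symMixFFAt_inl_inr, symHessFFAt_inl_inr, sub_self, Finset.sum_const_zero, smul_eq_mul, mul_zero]
  · simp only [symMixFFAt_inr, symHessFFAt_inr, sub_self, Finset.sum_const_zero, smul_eq_mul, mul_zero]
  · simp only [symMixFFAt_inr, symHessFFAt_inr, sub_self, Finset.sum_const_zero, smul_eq_mul, mul_zero]

/-! ## §2 The record's instance (`d = 3`, root `ρ_c`, level `0`) -/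

section Record

variable {n : ℕ} [NeZero n]

/-- [folklore] The record's weighted mixed table at level `0` IS an1's symmetrised mixed table (`wM2 0 = 1`). -/
theorem M2Of_symTablesAn1S2_mixFF_zero (cΛ : ℝ) :
    M2Of 3 n (symTablesAn1S2 3 n cΛ).mixFF 0 = symMixFFAt (ctr 4 n) n := by
  funext κ u ρ w
  simp only [M2Of, wM2, symTablesAn1S2_mixFF, pow_zero, one_pow, one_smul]

/-- [folklore] The record's multiplier table at level `0` is `cΛ •` an1's symmetrised constraint Hessian (`wM1 0 = 1`). -/
theorem symTablesAn1S2_M_zero_apply (cΛ : ℝ) (ρ : Fin 4) (w : Site 4) :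
    (symTablesAn1S2 3 n cΛ).M 0 ρ w = cΛ • symHessFFAt (ctr 4 n) n ρ w := by
  simp only [symTablesAn1S2_M, M1Of_apply, wM1, pow_zero, one_pow, mul_one]

open Classical in
/-- **THE RECORD's MIXED SLOT LETTER, TABLE-`H` FORM** [folklore] (C-g24-4; no side condition): with `H := symHessFFAt ρ_c n`,
`divV (κ u ↦ M2Of 3 n (symTablesAn1S2 3 n cΛ).mixFF 0 κ u ρ w) u′ = 2 • ([u′ = n•w + ρ_c] • H ρ w − diagK (legInd ρ_c u′) ∘ H ρ w)`. -/
theorem divV_M2Of_record_eq (cΛ : ℝ) (ρ : Fin 4) (w u' : Site 4) :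
    divV (fun κ u => M2Of 3 n (symTablesAn1S2 3 n cΛ).mixFF 0 κ u ρ w) u'
      = (2 : ℝ) • ((if u' = (n : ℤ) • w + ctr 4 n then (1 : ℝ) else 0) • symHessFFAt (ctr 4 n) n ρ w
          - comp (diagK (legInd (ctr 4 n) u')) (symHessFFAt (ctr 4 n) n ρ w)) := by
  rw [M2Of_symTablesAn1S2_mixFF_zero]
  exact divV_symMixFFAt_eq (NeZero.ne n) (ctr 4 n) ρ w u'

open Classical in
/-- **THE RECORD's MIXED SLOT LETTER IN TT20's `hMsite` FORM** [folklore] (C-g24-4; against the record's OWN multiplier table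
`M⁰ := (symTablesAn1S2 3 n cΛ).M 0 = cΛ • H`, scalar `ξ′ = 2∕cΛ`, UNDER `cΛ ≠ 0` — displayed):
`divV (κ u ↦ M₂⁰ κ u ρ w) u′ = (2∕cΛ) • ([u′ = n•w + ρ_c] • M⁰ ρ w − diagK (legInd ρ_c u′) ∘ M⁰ ρ w)`. -/
theorem divV_M2Of_record_eq_smul_M (cΛ : ℝ) (hc : cΛ ≠ 0) (ρ : Fin 4) (w u' : Site 4) :
    divV (fun κ u => M2Of 3 n (symTablesAn1S2 3 n cΛ).mixFF 0 κ u ρ w) u'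
      = (2 / cΛ) • ((if u' = (n : ℤ) • w + ctr 4 n then (1 : ℝ) else 0) • (symTablesAn1S2 3 n cΛ).M 0 ρ w
          - comp (diagK (legInd (ctr 4 n) u')) ((symTablesAn1S2 3 n cΛ).M 0 ρ w)) := by
  rw [divV_M2Of_record_eq, symTablesAn1S2_M_zero_apply]
  funext x z a b
  simp only [Pi.smul_apply, Pi.sub_apply, comp_diagK_left, smul_eq_mul]
  field_simp

end Record

end Summit.QuantumFields.BalabanUV.Beta.D1BFx.CombMixedSiteLetter

end
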